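import Literature.Analysis.FluidPDE.IsentropicEulerTorusUniqueness
import Literature.Analysis.FunctionSpaces.FlatTorusProofs
import HarnessLib

/-!
# Lattice-periodic classical solutions on `ℝ³` are classical solutions on `𝕋³` (theorems only)

Topic `Literature/Analysis/FluidPDE`; namespace `Literature.Analysis.FluidPDE.IsentropicEuler`.
Companion of `IsentropicEulerTorusUniqueness.lean` (the opposite direction: the periodic LIFT of
a classical solution on `𝕋³` solves the equations on `ℝ³`). THEOREMS ONLY, no new facts (D-0026).

The solution notion of the implosion facts (`IsIsentropicEulerSolution γ T ρ u`,
`CompressibleEulerImplosion.lean`: jointly `C^∞` fields on `[0, T) × 𝕋³`, `ρ > 0`, mass and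
momentum equations in the torus calculus `Torus.timeDerivWithin (Ico 0 T)`, `Torus.divergence`,
`Torus.partialDeriv`, `Torus.gradient`) is fed, in the deduction of the periodic implosion from a
whole-space one "via finite speed of propagation" (Cao-Labora–Gómez-Serrano–Shi–Staffilani,
Rem. 1.5), by a classical solution on `[0, T) × ℝ³` which is `ℤ³`-PERIODIC in space (a
whole-space solution equal to a constant state near the boundary of the unit cell, tiled). This
file proves that such a solution DESCENDS to a classical solution on `𝕋³`:

* `descend_proj`: `descend g (proj z) = g z` for lattice-periodic `g` (pointwise form of
  `Torus.lift_descend`);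
* `isIsentropicEulerSolution_descend`: if `P : ℝ → ℝ³ → ℝ`, `W : ℝ → ℝ³ → ℝ³` are
  `ℤ³`-periodic in space for every time, jointly `C^∞` on `[0, T) × ℝ³`, `P > 0`, and solve
  `∂ₜP + ∑ᵢ ∂ᵢ(P Wᵢ) = 0`, `P ∂ₜW + P ∑ᵢ Wᵢ ∂ᵢW + ∇(P^γ/γ) = 0` pointwise on `[0, T) × ℝ³`
  (one-sided time derivative within `[0, T)`, Mathlib `derivWithin`/`fderiv`/`gradient`), then
  `(t, x) ↦ (P t, W t)` descended to `𝕋³ = ℝ³/ℤ³` (`Torus.descend`) is an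
  `IsIsentropicEulerSolution γ T`;
* `derivWithin_Ico_eq_deriv_of_hasDerivAt`: the one-sided time derivative within `[0, T)` of a
  function differentiable at `t` is its derivative (to feed solutions defined for `t < T`, such as
  the exact self-similar solution of `CompressibleEulerExactSelfSimilarImplosion.lean`).

All folklore (torus derivatives at `proj z` are the Euclidean derivatives of the lift at `z`:
`IsentropicEuler.partialDeriv_proj_eq`, `IsentropicEuler.gradient_proj_eq`).
[cite: CaolaboraEtAl2025, Rem 1.5 p. 7; eq. (1.1) p. 3]
-/

noncomputable section

open Set Filter
open scoped Topology ContDiff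

namespace Literature.Analysis.FluidPDE

namespace IsentropicEuler

open Literature.MathematicalPhysics.KineticTheory (T3 V3)
open Literature.Analysis.FunctionSpaces

section Descent

/-- The descent of a lattice-periodic function, evaluated at `proj z`, is its value at `z`.
[folklore] -/
theorem descend_proj {F : Type*} (g : V3 → F) (hg : Torus.IsLatticePeriodic g) (z : V3) :
    Torus.descend g hg (Torus.proj z) = g z :=
  congrFun (Torus.lift_descend_holds g hg) z

/-- The one-sided derivative within `[0, T)` of a function differentiable at `t ∈ [0, T)` is its
derivative. [folklore] -/
theorem derivWithin_Ico_eq_deriv_of_hasDerivAt {F : Type*} [NormedAddCommGroup F]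
    [NormedSpace ℝ F] {f : ℝ → F} {f' : F} {T t : ℝ} (ht : t ∈ Ico 0 T) (hf : HasDerivAt f f' t) :
    derivWithin f (Ico 0 T) t = f' := by
  rw [hf.differentiableAt.derivWithin (uniqueDiffOn_Ico 0 T t ht), hf.deriv]

variable {γ T : ℝ} {P : ℝ → V3 → ℝ} {W : ℝ → V3 → V3}

/-- **Lattice-periodic classical solutions on `ℝ³` descend to classical solutions on `𝕋³`.**
Let `P`, `W` be `ℤ³`-periodic in space, jointly `C^∞` on `[0, T) × ℝ³`, `P > 0`, solving the
isentropic Euler system `∂ₜP + ∑ᵢ ∂ᵢ(P Wᵢ) = 0`, `P ∂ₜW + P ∑ᵢ Wᵢ ∂ᵢW + ∇(P^γ/γ) = 0`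
pointwise on `[0, T) × ℝ³` (time derivative within `[0, T)`). Then their descents to
`𝕋³ = ℝ³/ℤ³` form a classical solution in the sense of `IsIsentropicEulerSolution γ T`.
[cite: CaolaboraEtAl2025, eq. (1.1) p. 3 and Rem 1.5 p. 7] -/
theorem isIsentropicEulerSolution_descend
    (hP : ∀ t, Torus.IsLatticePeriodic (P t)) (hW : ∀ t, Torus.IsLatticePeriodic (W t))
    (hPs : ContDiffOn ℝ ∞ (fun p : ℝ × V3 => P p.1 p.2) (Ico 0 T ×ˢ univ))
    (hWs : ContDiffOn ℝ ∞ (fun p : ℝ × V3 => W p.1 p.2) (Ico 0 T ×ˢ univ))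
    (hpos : ∀ t ∈ Ico 0 T, ∀ z, 0 < P t z)
    (hmass : ∀ t ∈ Ico 0 T, ∀ z, derivWithin (fun s => P s z) (Ico 0 T) t +
      ∑ i, fderiv ℝ (fun w => P t w * W t w i) z (EuclideanSpace.single i 1) = 0)
    (hmom : ∀ t ∈ Ico 0 T, ∀ z, P t z • derivWithin (fun s => W s z) (Ico 0 T) t +
        P t z • ∑ i, W t z i • fderiv ℝ (W t) z (EuclideanSpace.single i 1) +
      gradient (fun w => P t w ^ γ / γ) z = 0) :
    IsIsentropicEulerSolution γ T (fun t => Torus.descend (P t) (hP t))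
      (fun t => Torus.descend (W t) (hW t)) := by
  -- the descents evaluated at `proj z`, and the lift of the velocity
  have hρ : ∀ t z, Torus.descend (P t) (hP t) (Torus.proj z) = P t z :=
    fun t z => descend_proj _ _ z
  have hu : ∀ t z, Torus.descend (W t) (hW t) (Torus.proj z) = W t z :=
    fun t z => descend_proj _ _ z
  have hlu : ∀ t, Torus.lift (Torus.descend (W t) (hW t)) = W t :=
    fun t => Torus.lift_descend_holds _ _
  -- slice regularity
  have hPt : ∀ t ∈ Ico 0 T, ContDiff ℝ ∞ (P t) := fun t ht => by
    change ContDiff ℝ ∞ ((fun p : ℝ × V3 => P p.1 p.2) ∘ fun y : V3 => (t, y))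
    exact hPs.comp_contDiff (contDiff_prodMk_right t) fun y => Set.mk_mem_prod ht (Set.mem_univ y)
  have hWt : ∀ t ∈ Ico 0 T, ContDiff ℝ ∞ (W t) := fun t ht => by
    change ContDiff ℝ ∞ ((fun p : ℝ × V3 => W p.1 p.2) ∘ fun y : V3 => (t, y))
    exact hWs.comp_contDiff (contDiff_prodMk_right t) fun y => Set.mk_mem_prod ht (Set.mem_univ y)
  refine ⟨?_, ?_, ?_, ?_, ?_⟩
  · -- joint smoothness of the density: its space–time lift is `P`
    change ContDiffOn ℝ ∞ (fun p : ℝ × V3 => Torus.descend (P p.1) (hP p.1) (Torus.proj p.2))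
      (Ico 0 T ×ˢ univ)
    exact hPs.congr fun p _ => hρ p.1 p.2
  · change ContDiffOn ℝ ∞ (fun p : ℝ × V3 => Torus.descend (W p.1) (hW p.1) (Torus.proj p.2))
      (Ico 0 T ×ˢ univ)
    exact hWs.congr fun p _ => hu p.1 p.2
  · intro t ht x
    obtain ⟨z, rfl⟩ := Torus.proj_surjective x
    rw [hρ]
    exact hpos t ht z
  · -- mass
    intro t ht x
    obtain ⟨z, rfl⟩ := Torus.proj_surjective x
    have h1 : Torus.timeDerivWithin (Ico 0 T) (fun s => Torus.descend (P s) (hP s)) t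
        (Torus.proj z) = derivWithin (fun s => P s z) (Ico 0 T) t := by
      change derivWithin _ _ _ = _
      congr 1
      funext s
      exact hρ s z
    have h2 : Torus.divergence (fun y => Torus.descend (P t) (hP t) y •
        Torus.descend (W t) (hW t) y) (Torus.proj z) =
        ∑ i, fderiv ℝ (fun w => P t w * W t w i) z (EuclideanSpace.single i 1) := by
      change ∑ i, Torus.partialDeriv i _ _ = _
      refine Finset.sum_congr rfl fun i _ => ?_
      have hl : Torus.lift (fun y => (Torus.descend (P t) (hP t) y •
          Torus.descend (W t) (hW t) y) i) = fun w => P t w * W t w i := by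
        funext w
        simp only [Torus.lift_apply, hρ, hu, PiLp.smul_apply, smul_eq_mul]
      have hg : Torus.IsContDiff 1 (fun y => (Torus.descend (P t) (hP t) y •
          Torus.descend (W t) (hW t) y) i) := by
        change ContDiff ℝ 1 (Torus.lift _)
        rw [hl]
        exact ((hPt t ht).mul (contDiff_euclidean.1 (hWt t ht) i)).of_le (by norm_cast)
      rw [partialDeriv_proj_eq hg, hl]
    rw [h1, h2]
    exact hmass t ht z
  · -- momentum
    intro t ht x
    obtain ⟨z, rfl⟩ := Torus.proj_surjective x
    have h1 : Torus.timeDerivWithin (Ico 0 T) (fun s => Torus.descend (W s) (hW s)) t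
        (Torus.proj z) = derivWithin (fun s => W s z) (Ico 0 T) t := by
      change derivWithin _ _ _ = _
      congr 1
      funext s
      exact hu s z
    have h2 : ∀ i, Torus.partialDeriv i (Torus.descend (W t) (hW t)) (Torus.proj z) =
        fderiv ℝ (W t) z (EuclideanSpace.single i 1) := by
      intro i
      have hg : Torus.IsContDiff 1 (Torus.descend (W t) (hW t)) := by
        change ContDiff ℝ 1 (Torus.lift _)
        rw [hlu]
        exact (hWt t ht).of_le (by norm_cast)
      rw [partialDeriv_proj_eq hg, hlu]
    have h3 : Torus.gradient (fun y => Torus.descend (P t) (hP t) y ^ γ / γ) (Torus.proj z) =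
        gradient (fun w => P t w ^ γ / γ) z := by
      rw [gradient_proj_eq]
      congr 1
      funext w
      simp only [Torus.lift_apply, hρ]
    rw [h1, h3, hρ, hu]
    simp only [h2]
    exact hmom t ht z

end Descent

end IsentropicEuler

end Literature.Analysis.FluidPDE
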